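import Summits.Ventures.HSemireg.CliqueUnitsClassDead
import Summits.Ventures.HSemireg.CliqueFourDigit
import Summits.Ventures.HSemireg.CliqueThreeDigit

/-!
# The three `q = 4` clique units are CLASS-DEAD for EVERY integral class 2-form (pub-hsemireg, S4-PUSH corner 2)

Kernel leg of seat s4-search-2 gen 17 (cell `pub-hsemireg`), ROW X; compositions of ROW L2
(`CliqueUnitsClassDead.classDead_Km2235 ∕ _Km2244 ∕ _Km2334`: the clique units of types (2,2,2,2,3,5), (2,2,2,2,4,4),
(2,2,2,3,3,4) fail CRITERION L at `k = 3` for every completion `B = P₁ + 2Z` of the clique leading digit) with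
ROWS W4 ∕ W3.  For each type the registered `T₂ = σ₂D₂ − 4σ₁DB + 16σ₀B₂` (`σ₁ = 0`, `σ₂ = 4t − σ₀`, `σ₀ = 2s + 1`,
`D₂ ≡ 16P₂ (mod 32Λ)` by the type's closed form) is `16(B₂ − P₂) + 32W₁`; so `T₂ = 64Z₂` forces
`B·B = 2P₂ + 4W₀` (cancel `16`), and `clique4_digit` ∕ `clique3_digit` give `B = P₁ + 2Z` — ROW L2's `hB`
(`<type>_leadingDigit_of_criterionL_two`).  Hence `classDead_<type>_of_mem_span`: ROW L2's theorem with `mZspan ∕ hB`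
REPLACED by `mB : B ∈ span`, `¬(T₂ = 64·Z₂ ∧ T₃ = 256·Z')` — CRITERION L fails at `k = 2` or `k = 3` for EVERY
integral class 2-form of these types, no leading-digit hypothesis.  (The four `q = 2` clique types of ROW L2 — `T_k` with
`(−2)^j`, modulus `8` at `k = 2`, `T₂ = 4(B₂ − P₂) + 8W₁` — are `CliqueTwoEveryDigit.lean`, ROW X2.)

Scope ∕ honest framing as in ROW L2: CLASS-LEVEL, NECESSARY-condition bookkeeping (CRITERION L) at the special fibre
`E⁶`; CRITERION L as the registered necessary condition, the signature table and the census remain framework words;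
theorems only (count-neutral, no `def`); no object, no `σ` computation, no Hodge statement; nothing here bears on
HC ∕ HC_CM ∕ HC_AV.
-/

namespace Summit.Ventures.HSemireg.CliqueEveryDigit

open ExteriorAlgebra DecomposableTwoForms CliqueFourDigit CliqueThreeDigit CliqueUnitsClassDead

variable {M : Type*} [AddCommGroup M] [Module ℤ M]

/-- **The clique leading digit of type 2235, from CRITERION L at `k = 2`.**  In the setting of ROW L2's
`classDead_Km2235` the registered `T₂ = σ₂D₂ − 4σ₁DB + 16σ₀B₂` is `16(B₂ − P₂) + 32W₁`; for ANY integral class 2-form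
`B` with `B·B = 2B₂`, `T₂ = 64·Z₂` forces `B = P₁ + 2Z` with `Z` in the span of the 2-vectors (ROW L2's `hB`). -/
theorem Km2235_leadingDigit_of_criterionL_two (x : Module.Basis (Fin 12) ℤ M)
    (h₀ h₁ h₂ h₃ h₄ h₅ σ₀ σ₁ σ₂ s t P₁ P₂ D D₂ B B₂ T₂ Z₂ : ExteriorAlgebra ℤ M)
    (hh₀ : h₀ = ι ℤ (x 0) * ι ℤ (x 1)) (hh₁ : h₁ = ι ℤ (x 2) * ι ℤ (x 3)) (hh₂ : h₂ = ι ℤ (x 4) * ι ℤ (x 5))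
    (hh₃ : h₃ = ι ℤ (x 6) * ι ℤ (x 7))
    (hP₁ : P₁ = h₀ + h₁ + h₂ + h₃)
    (hP₂ : P₂ = h₀ * h₁ + h₀ * h₂ + h₀ * h₃ + h₁ * h₂ + h₁ * h₃ + h₂ * h₃)
    (hD₂ : D₂ = (256) * h₄ * h₅ + (128) * P₁ * h₅ + (32) * P₁ * h₄ + (16) * P₂)
    (mB : B ∈ Submodule.span ℤ (Set.range fun p : M × M => ι ℤ p.1 * ι ℤ p.2)) (qB : B * B = 2 * B₂)
    (hσ₁ : σ₁ = 0) (hσ₂ : σ₂ = 4 * t - σ₀) (hσ₀ : σ₀ = 2 * s + 1)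
    (hT₂ : T₂ = σ₂ * D₂ - 4 * σ₁ * (D * B) + 16 * σ₀ * B₂) (hcrit : T₂ = 64 * Z₂) :
    ∃ Z ∈ Submodule.span ℤ (Set.range fun p : M × M => ι ℤ p.1 * ι ℤ p.2), B = P₁ + 2 * Z := by
  obtain ⟨W₁, hW₁⟩ : ∃ W₁ : ExteriorAlgebra ℤ M, W₁ = 2 * t * P₂ + 4 * t * (P₁ * h₄) + 16 * t * (P₁ * h₅) + 32 * t * (h₄ * h₅) - s * P₂ - 2 * s * (P₁ * h₄) - 8 * s * (P₁ * h₅) - 16 * s * (h₄ * h₅) - P₁ * h₄ - 4 * (P₁ * h₅) - 8 * (h₄ * h₅) + s * B₂ := ⟨_, rfl⟩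
  have e : T₂ = 32 * W₁ + 16 * (B₂ - P₂) := by
    rw [hW₁, hT₂, hσ₁, hσ₂, hσ₀, hD₂]; noncomm_ring
  have h16 : (16 : ExteriorAlgebra ℤ M) * (B₂ - P₂) = 16 * (2 * (2 * Z₂ - W₁)) := by
    rw [eq_sub_of_add_eq' (e.symm.trans hcrit)]; noncomm_ring
  have hB₂ : B₂ = P₂ + 2 * (2 * Z₂ - W₁) := by
    have h := LeadingDigitRemainder.natCast_mul_cancel x 16 (by norm_num) _ _ (by exact_mod_cast h16)
    rw [← h]; abel
  have hBB : B * B = 2 * (ι ℤ (x 0) * ι ℤ (x 1) * (ι ℤ (x 2) * ι ℤ (x 3)) + ι ℤ (x 0) * ι ℤ (x 1) * (ι ℤ (x 4) * ι ℤ (x 5))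
      + ι ℤ (x 0) * ι ℤ (x 1) * (ι ℤ (x 6) * ι ℤ (x 7)) + ι ℤ (x 2) * ι ℤ (x 3) * (ι ℤ (x 4) * ι ℤ (x 5))
      + ι ℤ (x 2) * ι ℤ (x 3) * (ι ℤ (x 6) * ι ℤ (x 7)) + ι ℤ (x 4) * ι ℤ (x 5) * (ι ℤ (x 6) * ι ℤ (x 7)))
      + 4 * (2 * Z₂ - W₁) := by
    rw [qB, hB₂, hP₂, hh₀, hh₁, hh₂, hh₃]; noncomm_ring
  obtain ⟨c, h0, hskew, hBc⟩ := exists_coeff_of_mem_span x B mB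
  obtain ⟨Z, mZ, hZ⟩ := clique4_digit x c h0 hskew B _ hBc hBB
  refine ⟨Z, mZ, ?_⟩
  rw [hP₁, hh₀, hh₁, hh₂, hh₃, hZ]

/-- **THE 2235 CLIQUE UNIT IS CLASS-DEAD FOR EVERY INTEGRAL CLASS 2-FORM.**  ROW L2's `classDead_Km2235` with
`mZspan`, `hB : B = P₁ + 2Z` REPLACED by `mB : B ∈ span` (and the registered `T₂` added to the signature):
`¬(T₂ = 64·Z₂ ∧ T₃ = 256·Z')` for all `Z₂, Z'`. -/
theorem classDead_Km2235_of_mem_span (x : Module.Basis (Fin 12) ℤ M) (Λ : Subalgebra ℤ (ExteriorAlgebra ℤ M))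
    (h₀ h₁ h₂ h₃ h₄ h₅ σ₀ σ₁ σ₂ σ₃ s t u P₁ P₂ P₃ D D₂ D₃ B B₂ B₃ T₂ T₃ : ExteriorAlgebra ℤ M)
    (hΛ : Λ = Algebra.adjoin ℤ (Set.range fun p : M × M => ι ℤ p.1 * ι ℤ p.2))
    (hh₀ : h₀ = ι ℤ (x 0) * ι ℤ (x 1)) (hh₁ : h₁ = ι ℤ (x 2) * ι ℤ (x 3)) (hh₂ : h₂ = ι ℤ (x 4) * ι ℤ (x 5))
    (hh₃ : h₃ = ι ℤ (x 6) * ι ℤ (x 7)) (hh₄ : h₄ = ι ℤ (x 8) * ι ℤ (x 9)) (hh₅ : h₅ = ι ℤ (x 10) * ι ℤ (x 11))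
    (ms : s ∈ Λ) (mt : t ∈ Λ) (mu : u ∈ Λ)
    (hP₁ : P₁ = h₀ + h₁ + h₂ + h₃)
    (hP₂ : P₂ = h₀ * h₁ + h₀ * h₂ + h₀ * h₃ + h₁ * h₂ + h₁ * h₃ + h₂ * h₃)
    (hP₃ : P₃ = h₀ * h₁ * h₂ + h₀ * h₁ * h₃ + h₀ * h₂ * h₃ + h₁ * h₂ * h₃)
    (hD : D = 4 * P₁ + 8 * h₄ + 32 * h₅)
    (hD₂ : D₂ = (256) * h₄ * h₅ + (128) * P₁ * h₅ + (32) * P₁ * h₄ + (16) * P₂)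
    (hD₃ : D₃ = (1024) * P₁ * h₄ * h₅ + (512) * P₂ * h₅ + (128) * P₂ * h₄ + (64) * P₃)
    (mB : B ∈ Submodule.span ℤ (Set.range fun p : M × M => ι ℤ p.1 * ι ℤ p.2))
    (qB : B * B = 2 * B₂) (cB : B * B * B = 6 * B₃)
    (hσ₁ : σ₁ = 0) (hσ₂ : σ₂ = 4 * t - σ₀) (hσ₀ : σ₀ = 2 * s + 1) (hσ₃ : σ₃ = 4 * u)
    (hT₂ : T₂ = σ₂ * D₂ - 4 * σ₁ * (D * B) + 16 * σ₀ * B₂)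
    (hT₃ : T₃ = σ₃ * D₃ - 4 * σ₂ * (D₂ * B) + 16 * σ₁ * (D * B₂) - 64 * σ₀ * B₃) :
    ∀ Z₂ Z' : ExteriorAlgebra ℤ M, ¬ (T₂ = 64 * Z₂ ∧ T₃ = 256 * Z') := by
  rintro Z₂ Z' ⟨hcrit₂, hcrit₃⟩
  obtain ⟨Z, mZ, hB⟩ := Km2235_leadingDigit_of_criterionL_two x h₀ h₁ h₂ h₃ h₄ h₅ σ₀ σ₁ σ₂ s t P₁ P₂ D D₂ B B₂
    T₂ Z₂ hh₀ hh₁ hh₂ hh₃ hP₁ hP₂ hD₂ mB qB hσ₁ hσ₂ hσ₀ hT₂ hcrit₂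
  exact classDead_Km2235 x Λ h₀ h₁ h₂ h₃ h₄ h₅ σ₀ σ₁ σ₂ σ₃ s t u P₁ P₂ P₃ D D₂ D₃ Z B B₂ B₃ T₃ hΛ hh₀ hh₁ hh₂ hh₃
    hh₄ hh₅ ms mt mu hP₁ hP₂ hP₃ hD hD₂ hD₃ mZ hB qB cB hσ₁ hσ₂ hσ₀ hσ₃ hT₃ Z' hcrit₃

/-- **The clique leading digit of type 2244, from CRITERION L at `k = 2`.**  In the setting of ROW L2's
`classDead_Km2244` the registered `T₂ = σ₂D₂ − 4σ₁DB + 16σ₀B₂` is `16(B₂ − P₂) + 32W₁`; for ANY integral class 2-form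
`B` with `B·B = 2B₂`, `T₂ = 64·Z₂` forces `B = P₁ + 2Z` with `Z` in the span of the 2-vectors (ROW L2's `hB`). -/
theorem Km2244_leadingDigit_of_criterionL_two (x : Module.Basis (Fin 12) ℤ M)
    (h₀ h₁ h₂ h₃ h₄ h₅ σ₀ σ₁ σ₂ s t P₁ P₂ D D₂ B B₂ T₂ Z₂ : ExteriorAlgebra ℤ M)
    (hh₀ : h₀ = ι ℤ (x 0) * ι ℤ (x 1)) (hh₁ : h₁ = ι ℤ (x 2) * ι ℤ (x 3)) (hh₂ : h₂ = ι ℤ (x 4) * ι ℤ (x 5))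
    (hh₃ : h₃ = ι ℤ (x 6) * ι ℤ (x 7))
    (hP₁ : P₁ = h₀ + h₁ + h₂ + h₃)
    (hP₂ : P₂ = h₀ * h₁ + h₀ * h₂ + h₀ * h₃ + h₁ * h₂ + h₁ * h₃ + h₂ * h₃)
    (hD₂ : D₂ = (256) * h₄ * h₅ + (64) * P₁ * h₅ + (64) * P₁ * h₄ + (16) * P₂)
    (mB : B ∈ Submodule.span ℤ (Set.range fun p : M × M => ι ℤ p.1 * ι ℤ p.2)) (qB : B * B = 2 * B₂)
    (hσ₁ : σ₁ = 0) (hσ₂ : σ₂ = 4 * t - σ₀) (hσ₀ : σ₀ = 2 * s + 1)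
    (hT₂ : T₂ = σ₂ * D₂ - 4 * σ₁ * (D * B) + 16 * σ₀ * B₂) (hcrit : T₂ = 64 * Z₂) :
    ∃ Z ∈ Submodule.span ℤ (Set.range fun p : M × M => ι ℤ p.1 * ι ℤ p.2), B = P₁ + 2 * Z := by
  obtain ⟨W₁, hW₁⟩ : ∃ W₁ : ExteriorAlgebra ℤ M, W₁ = 2 * t * P₂ + 8 * t * (P₁ * h₄) + 8 * t * (P₁ * h₅) + 32 * t * (h₄ * h₅) - s * P₂ - 4 * s * (P₁ * h₄) - 4 * s * (P₁ * h₅) - 16 * s * (h₄ * h₅) - 2 * (P₁ * h₄) - 2 * (P₁ * h₅) - 8 * (h₄ * h₅) + s * B₂ := ⟨_, rfl⟩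
  have e : T₂ = 32 * W₁ + 16 * (B₂ - P₂) := by
    rw [hW₁, hT₂, hσ₁, hσ₂, hσ₀, hD₂]; noncomm_ring
  have h16 : (16 : ExteriorAlgebra ℤ M) * (B₂ - P₂) = 16 * (2 * (2 * Z₂ - W₁)) := by
    rw [eq_sub_of_add_eq' (e.symm.trans hcrit)]; noncomm_ring
  have hB₂ : B₂ = P₂ + 2 * (2 * Z₂ - W₁) := by
    have h := LeadingDigitRemainder.natCast_mul_cancel x 16 (by norm_num) _ _ (by exact_mod_cast h16)
    rw [← h]; abel
  have hBB : B * B = 2 * (ι ℤ (x 0) * ι ℤ (x 1) * (ι ℤ (x 2) * ι ℤ (x 3)) + ι ℤ (x 0) * ι ℤ (x 1) * (ι ℤ (x 4) * ι ℤ (x 5))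
      + ι ℤ (x 0) * ι ℤ (x 1) * (ι ℤ (x 6) * ι ℤ (x 7)) + ι ℤ (x 2) * ι ℤ (x 3) * (ι ℤ (x 4) * ι ℤ (x 5))
      + ι ℤ (x 2) * ι ℤ (x 3) * (ι ℤ (x 6) * ι ℤ (x 7)) + ι ℤ (x 4) * ι ℤ (x 5) * (ι ℤ (x 6) * ι ℤ (x 7)))
      + 4 * (2 * Z₂ - W₁) := by
    rw [qB, hB₂, hP₂, hh₀, hh₁, hh₂, hh₃]; noncomm_ring
  obtain ⟨c, h0, hskew, hBc⟩ := exists_coeff_of_mem_span x B mB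
  obtain ⟨Z, mZ, hZ⟩ := clique4_digit x c h0 hskew B _ hBc hBB
  refine ⟨Z, mZ, ?_⟩
  rw [hP₁, hh₀, hh₁, hh₂, hh₃, hZ]

/-- **THE 2244 CLIQUE UNIT IS CLASS-DEAD FOR EVERY INTEGRAL CLASS 2-FORM.**  ROW L2's `classDead_Km2244` with
`mZspan`, `hB : B = P₁ + 2Z` REPLACED by `mB : B ∈ span` (and the registered `T₂` added to the signature):
`¬(T₂ = 64·Z₂ ∧ T₃ = 256·Z')` for all `Z₂, Z'`. -/
theorem classDead_Km2244_of_mem_span (x : Module.Basis (Fin 12) ℤ M) (Λ : Subalgebra ℤ (ExteriorAlgebra ℤ M))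
    (h₀ h₁ h₂ h₃ h₄ h₅ σ₀ σ₁ σ₂ σ₃ s t u P₁ P₂ P₃ D D₂ D₃ B B₂ B₃ T₂ T₃ : ExteriorAlgebra ℤ M)
    (hΛ : Λ = Algebra.adjoin ℤ (Set.range fun p : M × M => ι ℤ p.1 * ι ℤ p.2))
    (hh₀ : h₀ = ι ℤ (x 0) * ι ℤ (x 1)) (hh₁ : h₁ = ι ℤ (x 2) * ι ℤ (x 3)) (hh₂ : h₂ = ι ℤ (x 4) * ι ℤ (x 5))
    (hh₃ : h₃ = ι ℤ (x 6) * ι ℤ (x 7)) (hh₄ : h₄ = ι ℤ (x 8) * ι ℤ (x 9)) (hh₅ : h₅ = ι ℤ (x 10) * ι ℤ (x 11))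
    (ms : s ∈ Λ) (mt : t ∈ Λ) (mu : u ∈ Λ)
    (hP₁ : P₁ = h₀ + h₁ + h₂ + h₃)
    (hP₂ : P₂ = h₀ * h₁ + h₀ * h₂ + h₀ * h₃ + h₁ * h₂ + h₁ * h₃ + h₂ * h₃)
    (hP₃ : P₃ = h₀ * h₁ * h₂ + h₀ * h₁ * h₃ + h₀ * h₂ * h₃ + h₁ * h₂ * h₃)
    (hD : D = 4 * P₁ + 16 * h₄ + 16 * h₅)
    (hD₂ : D₂ = (256) * h₄ * h₅ + (64) * P₁ * h₅ + (64) * P₁ * h₄ + (16) * P₂)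
    (hD₃ : D₃ = (1024) * P₁ * h₄ * h₅ + (256) * P₂ * h₅ + (256) * P₂ * h₄ + (64) * P₃)
    (mB : B ∈ Submodule.span ℤ (Set.range fun p : M × M => ι ℤ p.1 * ι ℤ p.2))
    (qB : B * B = 2 * B₂) (cB : B * B * B = 6 * B₃)
    (hσ₁ : σ₁ = 0) (hσ₂ : σ₂ = 4 * t - σ₀) (hσ₀ : σ₀ = 2 * s + 1) (hσ₃ : σ₃ = 4 * u)
    (hT₂ : T₂ = σ₂ * D₂ - 4 * σ₁ * (D * B) + 16 * σ₀ * B₂)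
    (hT₃ : T₃ = σ₃ * D₃ - 4 * σ₂ * (D₂ * B) + 16 * σ₁ * (D * B₂) - 64 * σ₀ * B₃) :
    ∀ Z₂ Z' : ExteriorAlgebra ℤ M, ¬ (T₂ = 64 * Z₂ ∧ T₃ = 256 * Z') := by
  rintro Z₂ Z' ⟨hcrit₂, hcrit₃⟩
  obtain ⟨Z, mZ, hB⟩ := Km2244_leadingDigit_of_criterionL_two x h₀ h₁ h₂ h₃ h₄ h₅ σ₀ σ₁ σ₂ s t P₁ P₂ D D₂ B B₂
    T₂ Z₂ hh₀ hh₁ hh₂ hh₃ hP₁ hP₂ hD₂ mB qB hσ₁ hσ₂ hσ₀ hT₂ hcrit₂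
  exact classDead_Km2244 x Λ h₀ h₁ h₂ h₃ h₄ h₅ σ₀ σ₁ σ₂ σ₃ s t u P₁ P₂ P₃ D D₂ D₃ Z B B₂ B₃ T₃ hΛ hh₀ hh₁ hh₂ hh₃
    hh₄ hh₅ ms mt mu hP₁ hP₂ hP₃ hD hD₂ hD₃ mZ hB qB cB hσ₁ hσ₂ hσ₀ hσ₃ hT₃ Z' hcrit₃

/-- **The clique leading digit of type 2334, from CRITERION L at `k = 2`.**  In the setting of ROW L2's
`classDead_Km2334` the registered `T₂ = σ₂D₂ − 4σ₁DB + 16σ₀B₂` is `16(B₂ − P₂) + 32W₁`; for ANY integral class 2-form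
`B` with `B·B = 2B₂`, `T₂ = 64·Z₂` forces `B = P₁ + 2Z` with `Z` in the span of the 2-vectors (ROW L2's `hB`). -/
theorem Km2334_leadingDigit_of_criterionL_two (x : Module.Basis (Fin 12) ℤ M)
    (h₀ h₁ h₂ h₃ h₄ h₅ σ₀ σ₁ σ₂ s t P₁ P₂ D D₂ B B₂ T₂ Z₂ : ExteriorAlgebra ℤ M)
    (hh₀ : h₀ = ι ℤ (x 0) * ι ℤ (x 1)) (hh₁ : h₁ = ι ℤ (x 2) * ι ℤ (x 3)) (hh₂ : h₂ = ι ℤ (x 4) * ι ℤ (x 5))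
    (hP₁ : P₁ = h₀ + h₁ + h₂)
    (hP₂ : P₂ = h₀ * h₁ + h₀ * h₂ + h₁ * h₂)
    (hD₂ : D₂ = (128) * h₄ * h₅ + (128) * h₃ * h₅ + (64) * h₃ * h₄ + (64) * P₁ * h₅ + (32) * P₁ * h₄ + (32) * P₁ *
      h₃ + (16) * P₂)
    (mB : B ∈ Submodule.span ℤ (Set.range fun p : M × M => ι ℤ p.1 * ι ℤ p.2)) (qB : B * B = 2 * B₂)
    (hσ₁ : σ₁ = 0) (hσ₂ : σ₂ = 4 * t - σ₀) (hσ₀ : σ₀ = 2 * s + 1)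
    (hT₂ : T₂ = σ₂ * D₂ - 4 * σ₁ * (D * B) + 16 * σ₀ * B₂) (hcrit : T₂ = 64 * Z₂) :
    ∃ Z ∈ Submodule.span ℤ (Set.range fun p : M × M => ι ℤ p.1 * ι ℤ p.2), B = P₁ + 2 * Z := by
  obtain ⟨W₁, hW₁⟩ : ∃ W₁ : ExteriorAlgebra ℤ M, W₁ = 2 * t * P₂ + 4 * t * (P₁ * h₃) + 4 * t * (P₁ * h₄) + 8 * t * (P₁ * h₅) + 8 * t * (h₃ * h₄) + 16 * t * (h₃ * h₅) + 16 * t * (h₄ * h₅) - s * P₂ - 2 * s * (P₁ * h₃) - 2 * s * (P₁ * h₄) - 4 * s * (P₁ * h₅) - 4 * s * (h₃ * h₄) - 8 * s * (h₃ * h₅) - 8 * s * (h₄ * h₅) - P₁ * h₃ - P₁ * h₄ - 2 * (P₁ * h₅) - 2 * (h₃ * h₄) - 4 * (h₃ * h₅) - 4 * (h₄ * h₅) + s * B₂ := ⟨_, rfl⟩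
  have e : T₂ = 32 * W₁ + 16 * (B₂ - P₂) := by
    rw [hW₁, hT₂, hσ₁, hσ₂, hσ₀, hD₂]; noncomm_ring
  have h16 : (16 : ExteriorAlgebra ℤ M) * (B₂ - P₂) = 16 * (2 * (2 * Z₂ - W₁)) := by
    rw [eq_sub_of_add_eq' (e.symm.trans hcrit)]; noncomm_ring
  have hB₂ : B₂ = P₂ + 2 * (2 * Z₂ - W₁) := by
    have h := LeadingDigitRemainder.natCast_mul_cancel x 16 (by norm_num) _ _ (by exact_mod_cast h16)
    rw [← h]; abel
  have hBB : B * B = 2 * (ι ℤ (x 0) * ι ℤ (x 1) * (ι ℤ (x 2) * ι ℤ (x 3)) + ι ℤ (x 0) * ι ℤ (x 1) * (ι ℤ (x 4) * ι ℤ (x 5))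
      + ι ℤ (x 2) * ι ℤ (x 3) * (ι ℤ (x 4) * ι ℤ (x 5)))
      + 4 * (2 * Z₂ - W₁) := by
    rw [qB, hB₂, hP₂, hh₀, hh₁, hh₂]; noncomm_ring
  obtain ⟨c, h0, hskew, hBc⟩ := exists_coeff_of_mem_span x B mB
  obtain ⟨Z, mZ, hZ⟩ := clique3_digit x c h0 hskew B _ hBc hBB
  refine ⟨Z, mZ, ?_⟩
  rw [hP₁, hh₀, hh₁, hh₂, hZ]

/-- **THE 2334 CLIQUE UNIT IS CLASS-DEAD FOR EVERY INTEGRAL CLASS 2-FORM.**  ROW L2's `classDead_Km2334` with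
`mZspan`, `hB : B = P₁ + 2Z` REPLACED by `mB : B ∈ span` (and the registered `T₂` added to the signature):
`¬(T₂ = 64·Z₂ ∧ T₃ = 256·Z')` for all `Z₂, Z'`. -/
theorem classDead_Km2334_of_mem_span (x : Module.Basis (Fin 12) ℤ M) (Λ : Subalgebra ℤ (ExteriorAlgebra ℤ M))
    (h₀ h₁ h₂ h₃ h₄ h₅ σ₀ σ₁ σ₂ σ₃ s t u P₁ P₂ P₃ D D₂ D₃ B B₂ B₃ T₂ T₃ : ExteriorAlgebra ℤ M)
    (hΛ : Λ = Algebra.adjoin ℤ (Set.range fun p : M × M => ι ℤ p.1 * ι ℤ p.2))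
    (hh₀ : h₀ = ι ℤ (x 0) * ι ℤ (x 1)) (hh₁ : h₁ = ι ℤ (x 2) * ι ℤ (x 3)) (hh₂ : h₂ = ι ℤ (x 4) * ι ℤ (x 5))
    (hh₃ : h₃ = ι ℤ (x 6) * ι ℤ (x 7)) (hh₄ : h₄ = ι ℤ (x 8) * ι ℤ (x 9)) (hh₅ : h₅ = ι ℤ (x 10) * ι ℤ (x 11))
    (ms : s ∈ Λ) (mt : t ∈ Λ) (mu : u ∈ Λ)
    (hP₁ : P₁ = h₀ + h₁ + h₂)
    (hP₂ : P₂ = h₀ * h₁ + h₀ * h₂ + h₁ * h₂)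
    (hP₃ : P₃ = h₀ * h₁ * h₂)
    (hD : D = 4 * P₁ + 8 * h₃ + 8 * h₄ + 16 * h₅)
    (hD₂ : D₂ = (128) * h₄ * h₅ + (128) * h₃ * h₅ + (64) * h₃ * h₄ + (64) * P₁ * h₅ + (32) * P₁ * h₄ + (32) * P₁ *
      h₃ + (16) * P₂)
    (hD₃ : D₃ = (1024) * h₃ * h₄ * h₅ + (512) * P₁ * h₄ * h₅ + (512) * P₁ * h₃ * h₅ + (256) * P₁ * h₃ * h₄ + (256)
      * P₂ * h₅ + (128) * P₂ * h₄ + (128) * P₂ * h₃ + (64) * P₃)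
    (mB : B ∈ Submodule.span ℤ (Set.range fun p : M × M => ι ℤ p.1 * ι ℤ p.2))
    (qB : B * B = 2 * B₂) (cB : B * B * B = 6 * B₃)
    (hσ₁ : σ₁ = 0) (hσ₂ : σ₂ = 4 * t - σ₀) (hσ₀ : σ₀ = 2 * s + 1) (hσ₃ : σ₃ = 4 * u)
    (hT₂ : T₂ = σ₂ * D₂ - 4 * σ₁ * (D * B) + 16 * σ₀ * B₂)
    (hT₃ : T₃ = σ₃ * D₃ - 4 * σ₂ * (D₂ * B) + 16 * σ₁ * (D * B₂) - 64 * σ₀ * B₃) :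
    ∀ Z₂ Z' : ExteriorAlgebra ℤ M, ¬ (T₂ = 64 * Z₂ ∧ T₃ = 256 * Z') := by
  rintro Z₂ Z' ⟨hcrit₂, hcrit₃⟩
  obtain ⟨Z, mZ, hB⟩ := Km2334_leadingDigit_of_criterionL_two x h₀ h₁ h₂ h₃ h₄ h₅ σ₀ σ₁ σ₂ s t P₁ P₂ D D₂ B B₂
    T₂ Z₂ hh₀ hh₁ hh₂ hP₁ hP₂ hD₂ mB qB hσ₁ hσ₂ hσ₀ hT₂ hcrit₂
  exact classDead_Km2334 x Λ h₀ h₁ h₂ h₃ h₄ h₅ σ₀ σ₁ σ₂ σ₃ s t u P₁ P₂ P₃ D D₂ D₃ Z B B₂ B₃ T₃ hΛ hh₀ hh₁ hh₂ hh₃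
    hh₄ hh₅ ms mt mu hP₁ hP₂ hP₃ hD hD₂ hD₃ mZ hB qB cB hσ₁ hσ₂ hσ₀ hσ₃ hT₃ Z' hcrit₃

end Summit.Ventures.HSemireg.CliqueEveryDigit
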